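import Literature.NumberTheory.LFunctions.PrimeReciprocalSumLogLogGamma
import Literature.NumberTheory.LFunctions.RobinNumerical
import Mathlib.Data.Nat.Factorization.Induction
import HarnessLib

/-!
# Robin's inequality for every squarefree and every odd integer
# (Choie–Lichiardopol–Moree–Solé 2007, Thms 1.1, 1.2, 2.1), unconditionally

Topic `Literature/NumberTheory/LFunctions`. Everything here is PROVED (the only `def`s are the
exceptional set `𝓑`, a kernel-evaluable numerical checker and its table); no named fact.

Y. Choie, N. Lichiardopol, P. Moree, P. Solé, *On Robin's criterion for the Riemann hypothesis*,
J. Théor. Nombres Bordeaux 19 (2007) 357–372, **Theorem 1.1** (p. 358): "Put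
`𝓑 = {2, 3, 5, 6, 10, 30}`. Every squarefree integer that is not in `𝓑` is an element of `𝓡`",
where `𝓡 = {n ≥ 1 : σ(n) < e^γ n log log n}` (Robin's inequality, the tree's
`Literature.NumberTheory.LFunctions.robinInequality`). AS-PRINTED FLAG: `n = 1` is squarefree, not
in `𝓑`, and NOT in `𝓡` (`σ(1) = 1`; it is the first element of their exceptional list `𝓐`, p. 357,
and their induction starts at `ω(n) = 1`), so the typed statement excludes `n = 1`
(`robinInequality_of_squarefree`: squarefree `n ≠ 1`, `n ∉ 𝓑`). This is, with Theorem 1.2 (odd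
integers), the unconditional infinite-family case of Robin's criterion proved "using only very
elementary methods" (p. 358); the tree's `t`-free theorems (`Summits/Ventures/RobinTFree/`) are
conditional on explicit `θ`-bounds.

The proof printed in §2 is followed step by step, on the finite set `s` of prime factors
(`n = ∏_{p∈s} p`, `σ(n) = ∏_{p∈s} (p+1)`, `sigma_prod_primes`), by induction on the largest prime
`q = q_m` (Mathlib's `Finset.induction_on_max`), `n = q·n₁`:
* `ω(n) = 1`: primes `q ≥ 7` (`(q+1)/q ≤ 8/7 < e^γ log log 7`);
* `n₁ ∈ 𝓑`: their Corollary 2.1 ("If `r` is in `𝓑` and `q ≥ 7` is a prime, then `rq` is in `𝓡`":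
  `q = 7` directly, `q ≥ 11` from `(12/11) σ(r)/r < e^γ log log(11 r)`), and `n = 15` when `q ≤ 5`
  (`robinInequality_mul_of_mem_setB`);
* Case 1, `q ≥ log n`: `(q+1) log log n₁ ≤ q log log n` from `log b − log a ≥ (b − a)/b`
  (their (2.1)–(2.3); `case_one`);
* Case 2, `q < log n`: `∏_{p∈s}(1 + 1/p) < exp(∑_{p ≤ q} 1/p) ≤ exp(γ + log log q) = e^γ log q
  < e^γ log log n`, by their Lemma 2.1 (2) — the tree's PROVED
  `Literature.NumberTheory.LFunctions.primeRecipSum_le_loglog_add_eulerMascheroni`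
  (`PrimeReciprocalSumLogLogGamma.lean`).
The fourteen numerical instances of Robin's inequality used (`n = 15`, the primes via `n = 7`,
`7r` and `11r` for `r ∈ 𝓑`) are one kernel computation (`riTable_ok`: `σ`-ratios against
`1.7802 · log log N`, `log log N` rounded down by the kernel logarithm `KernelLog.logIv`,
`e^γ > 1.7802` from `RobinNumerical.lean`).

Then (§§6–8 of this file): `σ(n)φ(n) ≤ n²` (Hardy–Wright Thm 329, giving their (2.7)
`σ(n)/n ≤ n/φ(n)`); **Theorem 2.1** (`n/φ(n) < e^γ log log n` for odd `n ∉ {1,3,5,9,15}`: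
`n/φ(n) = κ/φ(κ)` for the squarefree kernel `κ = q_1⋯q_m`, the shift bound
`∏ q_i/(q_i−1) ≤ (3/2)∏_{i<m}(1 + 1/q_i) = σ(n₁)/n₁`, `n₁ = 2κ/q_m`, and Theorem 1.1 at `n₁`, with
Lemma 2.3's `3^a 5^b q^c` cases as five more table rows); **Theorem 1.2** (Robin's inequality for
every odd `n ∉ {1,3,5,9}`). All axiom closures are the standard three (kernel-grade).

Not here: Theorem 1.3 (`RH ⟺` Robin's inequality for all even non-squarefree `n ≥ 5044`; it is
these two theorems plus the tree's `robin_iff_holds`, whose closure carries `native_decide`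
certificates — kept in a separate file); Theorems 1.4–1.6 (squarefull and 5-free integers; they
use Rosser–Schoenfeld's `∏_{p≤x} p/(p−1) ≤ e^γ(log x + 1/log x)`, Lemma 3.1, an explicit-PNT input).

## References

* Y. Choie, N. Lichiardopol, P. Moree, P. Solé, J. Théor. Nombres Bordeaux 19 (2007) 357–372,
  Thms 1.1–1.2 (p. 358), §2: Lemma 2.1, Lemma 2.2 / Corollary 2.1 (p. 360), proof of Thm 1.1
  ((2.1)–(2.5), pp. 360–361), Thm 2.1 (2.6), (2.7), Lemma 2.3, proofs of Thms 2.1 and 1.2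
  (pp. 361–363); arXiv:math/0604314. [CLMS2007]
* G. H. Hardy, E. M. Wright, *An Introduction to the Theory of Numbers*, 6th ed., Thm 329
  (`σ(n)φ(n) < n²`). [HardyWright2008]
* G. Robin, J. Math. Pures Appl. 63 (1984) 187–213 (Robin's inequality). [Robin1984]
-/

noncomputable section

open Finset Real
open scoped ArithmeticFunction.sigma

namespace Literature.NumberTheory.LFunctions

open ArithmeticFunction (isMultiplicative_sigma sigma_one_apply_prime_pow)
open Literature.Analysis.SpecialFunctions.KernelLog (logIv logIv_sound L2HI)

namespace CLMS2007

/-- The exceptional set `𝓑 = {2, 3, 5, 6, 10, 30}` of CLMS Theorem 1.1 (the squarefree members of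
their list `𝓐` of the `n ≤ 5040` violating Robin's inequality, other than `1`).
[cite: CLMS2007, Thm 1.1] -/
def setB : Finset ℕ := {2, 3, 5, 6, 10, 30}

/-! ### 1. `σ` of a squarefree number as a product over its primes -/

/-- `σ(p) = p + 1` for a prime `p`. [folklore] -/
private theorem sigma_one_prime {p : ℕ} (hp : p.Prime) : σ 1 p = p + 1 := by
  have h := sigma_one_apply_prime_pow hp (i := 1)
  rw [pow_one] at h
  rw [h, Finset.sum_range_succ, Finset.sum_range_succ, Finset.sum_range_zero]
  ring

/-- For a finite set `s` of primes, `σ(∏_{p∈s} p) = ∏_{p∈s} (p + 1)` (multiplicativity; CLMS (2.9)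
for squarefree `n`). [cite: CLMS2007, §2 eq. (2.7)] -/
theorem sigma_prod_primes (s : Finset ℕ) (hs : ∀ p ∈ s, p.Prime) :
    σ 1 (∏ p ∈ s, p) = ∏ p ∈ s, (p + 1) := by
  rw [isMultiplicative_sigma.map_prod_of_prime s hs]
  exact Finset.prod_congr rfl fun p hp => sigma_one_prime (hs p hp)

/-! ### 2. The numerical instances (kernel) -/

/-- The check `a/b < 1.7802 · v/2⁸⁰` where `v/2⁸⁰ ≤ log log N` is the kernel lower bound
`PrimeRecipSumBound.loglogLo N` of `PrimeReciprocalSumLogLogGamma.lean`. [folklore] -/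
def riChk (a b N : ℕ) : Bool :=
  match PrimeRecipSumBound.loglogLo N with
  | none => false
  | some v => decide ((a : ℤ) * 10000 * 2 ^ 80 < 17802 * (b : ℤ) * v)

/-- `80 log 2 ≤ 80 L2HI/2⁸⁰`. [folklore] -/
private theorem eighty_log_two_le : 80 * Real.log 2 ≤ ((80 * L2HI : ℤ) : ℝ) / 2 ^ 80 := by
  have h1 : (0.69314718055994530944 : ℚ) * 2 ^ 80 ≤ ((L2HI : ℤ) : ℚ) := Int.le_ceil _
  have h2 : (((0.69314718055994530944 : ℚ) * 2 ^ 80 : ℚ) : ℝ) ≤ (((L2HI : ℤ) : ℚ) : ℝ) := by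
    exact_mod_cast h1
  have h3 := Literature.Analysis.SpecialFunctions.Real.log_two_lt_d20
  push_cast at h2 ⊢
  rw [le_div_iff₀ (by positivity)]
  nlinarith

/-- Soundness of `PrimeRecipSumBound.loglogLo` (re-proved here; the original is file-private):
`v/2⁸⁰ ≤ log log N`. [folklore] -/
private theorem loglogLo_sound {n : ℕ} {v : ℤ} (h : PrimeRecipSumBound.loglogLo n = some v) :
    (v : ℝ) / 2 ^ 80 ≤ Real.log (Real.log n) := by
  rw [PrimeRecipSumBound.loglogLo] at h
  rcases hl : logIv n with _ | ⟨lg, hi⟩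
  · simp [hl] at h
  simp only [hl] at h
  by_cases hlg : 0 < lg
  · rw [if_pos hlg] at h
    rcases hl2 : logIv lg.toNat with _ | ⟨lg2, hi2⟩
    · simp [hl2] at h
    simp only [hl2, Option.some.injEq] at h
    subst h
    have h1 := (logIv_sound hl).1
    have h2 := (logIv_sound hl2).1
    have hlgR : ((lg.toNat : ℕ) : ℝ) = (lg : ℝ) := by
      have : ((lg.toNat : ℕ) : ℤ) = lg := Int.toNat_of_nonneg hlg.le
      exact_mod_cast this
    rw [hlgR] at h2
    have hlg0 : (0 : ℝ) < lg := by exact_mod_cast hlg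
    have h80 : (0 : ℝ) < 2 ^ 80 := by positivity
    have hpos : 0 < (lg : ℝ) / 2 ^ 80 := by positivity
    have h3 : Real.log ((lg : ℝ) / 2 ^ 80) ≤ Real.log (Real.log n) := Real.log_le_log hpos h1
    have h4 : Real.log ((lg : ℝ) / 2 ^ 80) = Real.log lg - 80 * Real.log 2 := by
      rw [Real.log_div hlg0.ne' h80.ne', Real.log_pow]; norm_num
    have h5 := eighty_log_two_le
    rw [h4] at h3
    have : ((lg2 - 80 * L2HI : ℤ) : ℝ) / 2 ^ 80 =
        (lg2 : ℝ) / 2 ^ 80 - ((80 * L2HI : ℤ) : ℝ) / 2 ^ 80 := by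
      push_cast; ring
    rw [this]
    linarith
  · rw [if_neg hlg] at h
    simp at h

/-- Soundness of `riChk`: `a/b < e^γ log log N` (with `e^γ > 1.7802`,
`RobinCheck.exp_eulerMascheroniConstant_gt`). [folklore] -/
private theorem lt_of_riChk {a b N : ℕ} (h : riChk a b N = true) (hb : 0 < b) :
    (a : ℝ) / b < exp eulerMascheroniConstant * Real.log (Real.log N) := by
  rw [riChk] at h
  rcases hv : PrimeRecipSumBound.loglogLo N with _ | v
  · simp [hv] at h
  simp only [hv, decide_eq_true_eq] at h
  have hll := loglogLo_sound hv
  have hγ := RobinCheck.exp_eulerMascheroniConstant_gt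
  have hbR : (0 : ℝ) < b := by exact_mod_cast hb
  have hR : (a : ℝ) * 10000 * 2 ^ 80 < 17802 * (b : ℝ) * v := by exact_mod_cast h
  have h1 : (a : ℝ) / b < 1.7802 * ((v : ℝ) / 2 ^ 80) := by
    rw [div_lt_iff₀ hbR]
    nlinarith
  have ha0 : (0 : ℝ) ≤ (a : ℝ) / b := by positivity
  have hv0 : (0 : ℝ) < (v : ℝ) / 2 ^ 80 := by nlinarith
  have hll0 : 0 < Real.log (Real.log N) := lt_of_lt_of_le hv0 hll
  nlinarith

/-- From a checked ratio to Robin's inequality: if `a/b < e^γ log log N`, `1 < N ≤ n` and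
`σ(n)·b ≤ a·n`, then `σ(n) < e^γ n log log n`. [folklore] -/
private theorem ri_of_riChk {n a b N : ℕ} (h : riChk a b N = true) (hb : 0 < b) (hN : 1 < N)
    (hNn : N ≤ n) (hσ : σ 1 n * b ≤ a * n) : robinInequality n := by
  unfold robinInequality
  have h1 := lt_of_riChk h hb
  have hbR : (0 : ℝ) < b := by exact_mod_cast hb
  have hNR : (1 : ℝ) < N := by exact_mod_cast hN
  have hNnR : (N : ℝ) ≤ n := by exact_mod_cast hNn
  have hn0 : (0 : ℝ) < n := by linarith
  have hσR : (σ 1 n : ℝ) * b ≤ a * n := by exact_mod_cast hσ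
  have hll : Real.log (Real.log N) ≤ Real.log (Real.log n) :=
    Real.log_le_log (Real.log_pos hNR) (Real.log_le_log (by linarith) hNnR)
  have hexp : 0 < exp eulerMascheroniConstant := exp_pos _
  have h2 : (σ 1 n : ℝ) ≤ (a : ℝ) / b * n := by
    rw [div_mul_eq_mul_div, le_div_iff₀ hbR]; exact hσR
  calc (σ 1 n : ℝ) ≤ (a : ℝ) / b * n := h2
    _ < exp eulerMascheroniConstant * Real.log (Real.log N) * n :=
        mul_lt_mul_of_pos_right h1 hn0
    _ ≤ exp eulerMascheroniConstant * Real.log (Real.log n) * n := by gcongr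
    _ = exp eulerMascheroniConstant * n * Real.log (Real.log n) := by ring

/-- The table of checked instances `(a, b, N)`: `a/b < 1.7802 log log N`. Rows: the primes
(`8/7`, `N = 7`), `n = 15`, and `8σ(r)/(7r)` at `N = 7r`, `12σ(r)/(11r)` at `N = 11r` for
`r ∈ 𝓑` (`σ(2,3,5,6,10,30) = 3,4,6,12,18,72`) (Theorem 1.1); then for Theorem 2.1 the
`n/φ(n)`-ratios `7/6` (`N = 7`), `15/8` (`N = 25`), `(7/6)(3/2)` (`N = 21`), `(7/6)(5/4)`
(`N = 35`), `(7/6)(15/8)` (`N = 105`). [folklore] -/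
def riTable : List (ℕ × ℕ × ℕ) :=
  [(8, 7, 7), (24, 15, 15),
   (24, 14, 14), (32, 21, 21), (48, 35, 35), (96, 42, 42), (144, 70, 70), (576, 210, 210),
   (36, 22, 22), (48, 33, 33), (72, 55, 55), (144, 66, 66), (216, 110, 110), (864, 330, 330),
   (7, 6, 7), (15, 8, 25), (7, 4, 21), (35, 24, 35), (35, 16, 105)]

/-- Kernel evaluation of the table (the tightest row is `24/14 = 1.7143 < 1.7802·log log 14 = 1.7275`).
[folklore] -/
private theorem riTable_ok : (riTable.all fun e => riChk e.1 e.2.1 e.2.2) = true := by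
  decide +kernel

/-- Extracting a row of the table. [folklore] -/
private theorem riChk_of_mem {a b N : ℕ} (h : (a, b, N) ∈ riTable) : riChk a b N = true := by
  have := List.all_eq_true.1 riTable_ok _ h
  simpa using this

/-! ### 3. The base instances: primes `≥ 7`, `n = 15`, and `r·q` for `r ∈ 𝓑`, `q ≥ 7` -/

/-- A prime not in `𝓑` is at least `7`. [folklore] -/
private theorem seven_le_of_prime_not_mem {q : ℕ} (hq : q.Prime) (hB : q ∉ setB) : 7 ≤ q := by
  by_contra h
  push Not at h
  interval_cases q
  all_goals first
    | exact absurd hq (by decide)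
    | exact absurd (by simp [setB]) hB

/-- Robin's inequality at the primes `q ≥ 7` (CLMS: "the assertion is easily provable for those
integers with `m = 1`"). [cite: CLMS2007, §2 (proof of Thm 1.1, `m = 1`)] -/
theorem robinInequality_prime {q : ℕ} (hq : q.Prime) (h7 : 7 ≤ q) : robinInequality q := by
  refine ri_of_riChk (a := 8) (b := 7) (N := 7) (riChk_of_mem (by simp [riTable])) (by norm_num)
    (by norm_num) h7 ?_
  rw [sigma_one_prime hq]
  nlinarith

/-- Robin's inequality at `15` ("We point out that `15` is in `𝓡`", p. 359). [cite: CLMS2007, §2] -/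
theorem robinInequality_fifteen : robinInequality 15 := by
  refine ri_of_riChk (a := 24) (b := 15) (N := 15) (riChk_of_mem (by simp [riTable])) (by norm_num)
    (by norm_num) le_rfl ?_
  have : σ 1 15 = 24 := by decide
  rw [this]

/-- **CLMS Corollary 2.1** ("If `r` is in `𝓑` and `q ≥ 7` is a prime, then `rq` is in `𝓡`"), in
the form used in the induction: for `r ∈ 𝓑`, a prime `q ≥ 7` and any `m` with
`σ(m) = (q + 1) σ(r)` and `m = q r`, Robin's inequality holds at `m`.
[cite: CLMS2007, §2 Cor. 2.1] -/
theorem robinInequality_mul_of_mem_setB {q r : ℕ} (hq : q.Prime) (h7 : 7 ≤ q) (hr : r ∈ setB)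
    {m : ℕ} (hm : m = q * r) (hσ : σ 1 m = (q + 1) * σ 1 r) : robinInequality m := by
  -- `σ(r)` for the six members of `𝓑`
  have hcases : (r = 2 ∧ σ 1 r = 3) ∨ (r = 3 ∧ σ 1 r = 4) ∨ (r = 5 ∧ σ 1 r = 6) ∨
      (r = 6 ∧ σ 1 r = 12) ∨ (r = 10 ∧ σ 1 r = 18) ∨ (r = 30 ∧ σ 1 r = 72) := by
    simp only [setB, Finset.mem_insert, Finset.mem_singleton] at hr
    rcases hr with rfl | rfl | rfl | rfl | rfl | rfl <;> decide
  have hr0 : 0 < r := by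
    rcases hcases with ⟨rfl, -⟩ | ⟨rfl, -⟩ | ⟨rfl, -⟩ | ⟨rfl, -⟩ | ⟨rfl, -⟩ | ⟨rfl, -⟩ <;> norm_num
  have hr2 : 2 ≤ r := by
    rcases hcases with ⟨rfl, -⟩ | ⟨rfl, -⟩ | ⟨rfl, -⟩ | ⟨rfl, -⟩ | ⟨rfl, -⟩ | ⟨rfl, -⟩ <;> norm_num
  -- either `q = 7` or `q ≥ 11`
  have hq' : q = 7 ∨ 11 ≤ q := by
    rcases Nat.lt_or_ge q 11 with h | h
    · left
      interval_cases q
      · rfl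
      all_goals exact absurd hq (by decide)
    · exact Or.inr h
  subst hm
  rcases hq' with rfl | h11
  · -- `q = 7`: the rows `(8σ(r), 7r, 7r)`
    refine ri_of_riChk (a := 8 * σ 1 r) (b := 7 * r) (N := 7 * r) ?_ (by omega) (by omega) le_rfl ?_
    · rcases hcases with ⟨rfl, hs⟩ | ⟨rfl, hs⟩ | ⟨rfl, hs⟩ | ⟨rfl, hs⟩ | ⟨rfl, hs⟩ | ⟨rfl, hs⟩ <;>
        (rw [hs]; exact riChk_of_mem (by decide))
    · rw [hσ]
  · -- `q ≥ 11`: the rows `(12σ(r), 11r, 11r)`, `(q+1)/q ≤ 12/11`, `log log (11r) ≤ log log (qr)`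
    refine ri_of_riChk (a := 12 * σ 1 r) (b := 11 * r) (N := 11 * r) ?_ (by omega) (by omega)
      (Nat.mul_le_mul_right _ h11) ?_
    · rcases hcases with ⟨rfl, hs⟩ | ⟨rfl, hs⟩ | ⟨rfl, hs⟩ | ⟨rfl, hs⟩ | ⟨rfl, hs⟩ | ⟨rfl, hs⟩ <;>
        (rw [hs]; exact riChk_of_mem (by decide))
    · rw [hσ]
      have := Nat.mul_le_mul_right (σ 1 r * r) h11
      nlinarith

/-! ### 4. Case 1 and Case 2 of the induction step -/

/-- **Case 1** (`q ≥ log n`, CLMS (2.1)–(2.3)): for reals `q ≥ 2`, `n₁ ≥ 2` with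
`log(q n₁) ≤ q`, `(q + 1) log log n₁ ≤ q log log (q n₁)` (from `log b − log a ≥ (b − a)/b`).
[cite: CLMS2007, §2 (proof of Thm 1.1, Case 1, (2.1)–(2.3))] -/
theorem case_one {q n₁ : ℝ} (hq : 2 ≤ q) (hn₁ : 2 ≤ n₁) (hcase : Real.log (q * n₁) ≤ q) :
    (q + 1) * Real.log (Real.log n₁) ≤ q * Real.log (Real.log (q * n₁)) := by
  have hq0 : 0 < q := by linarith
  have ha : 0 < Real.log n₁ := Real.log_pos (by linarith)
  have hlq : 0 < Real.log q := Real.log_pos (by linarith)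
  have hb_eq : Real.log (q * n₁) = Real.log q + Real.log n₁ :=
    Real.log_mul hq0.ne' (by linarith)
  set a := Real.log n₁ with ha_def
  set b := Real.log (q * n₁) with hb_def
  have hb : 0 < b := by rw [hb_eq]; linarith
  have hab : a ≤ b := by rw [hb_eq]; linarith
  -- `log b − log a ≥ (b − a)/b = log q / b`
  have h1 : (b - a) / b ≤ Real.log b - Real.log a := by
    have h := Real.log_le_sub_one_of_pos (show 0 < a / b by positivity)
    rw [Real.log_div ha.ne' hb.ne'] at h
    have : a / b - 1 = -((b - a) / b) := by field_simp; ring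
    linarith
  -- `q (log b − log a) ≥ q log q / b ≥ log q`
  have h2 : Real.log q ≤ q * (Real.log b - Real.log a) := by
    have hqb : 1 ≤ q / b := by rw [le_div_iff₀ hb]; linarith
    have : Real.log q ≤ q * ((b - a) / b) := by
      rw [show q * ((b - a) / b) = Real.log q * (q / b) by rw [hb_eq]; field_simp; ring]
      nlinarith
    nlinarith
  -- `log a ≤ log q` since `a ≤ b ≤ q`
  have h3 : Real.log a ≤ Real.log q := Real.log_le_log ha (hab.trans hcase)
  nlinarith

/-- `∑_{p∈s} 1/p ≤ ∑_{p ≤ q} 1/p` for a set `s` of primes `≤ q`. [folklore] -/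
private theorem sum_inv_le_primeRecipSum (s : Finset ℕ) (hs : ∀ p ∈ s, p.Prime) (q : ℕ)
    (hq : ∀ p ∈ s, p ≤ q) : ∑ p ∈ s, (p : ℝ)⁻¹ ≤ Mertens.primeRecipSum q := by
  rw [Mertens.primeRecipSum, Nat.floor_natCast]
  refine Finset.sum_le_sum_of_subset_of_nonneg (fun p hp => ?_) fun p _ _ => by positivity
  exact Nat.mem_primesLE.2 ⟨hq p hp, hs p hp⟩

/-- **Case 2** (`q < log n`): for a finite set `s` of primes all `≤ q`, `q ≥ 4`, and a real
`n` with `q < log n`, `∏_{p∈s} (1 + 1/p) < e^γ log log n`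
(`∏(1 + 1/p) ≤ exp ∑_{p≤q} 1/p ≤ exp(γ + log log q) = e^γ log q < e^γ log log n`).
[cite: CLMS2007, §2 (proof of Thm 1.1, Case 2, (2.4)–(2.5))] -/
theorem case_two (s : Finset ℕ) (hs : ∀ p ∈ s, p.Prime) {q : ℕ} (hq4 : 4 ≤ q)
    (hq : ∀ p ∈ s, p ≤ q) {n : ℝ} (hcase : (q : ℝ) < Real.log n) :
    ∏ p ∈ s, (1 + (p : ℝ)⁻¹) < exp eulerMascheroniConstant * Real.log (Real.log n) := by
  have hq0 : (0 : ℝ) < q := by exact_mod_cast (show 0 < q by omega)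
  -- `∏ (1 + 1/p) ≤ exp ∑ 1/p` (`1 + x ≤ eˣ`; the tree's
  -- `Literature.Barriers.Parity.FriedlanderGranville.prod_one_add_inv_le_exp`, inlined to keep imports light)
  have h1 : ∏ p ∈ s, (1 + (p : ℝ)⁻¹) ≤ Real.exp (∑ p ∈ s, (p : ℝ)⁻¹) := by
    rw [Real.exp_sum]
    exact Finset.prod_le_prod (fun p _ => by positivity) fun p _ => by
      linarith [Real.add_one_le_exp ((p : ℝ)⁻¹)]
  have h2 := sum_inv_le_primeRecipSum s hs q hq
  have h3 := primeRecipSum_le_loglog_add_eulerMascheroni (x := (q : ℝ)) (by exact_mod_cast hq4)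
  have hlogq : 0 < Real.log q := Real.log_pos (by exact_mod_cast (show 1 < q by omega))
  have h4 : Real.exp (∑ p ∈ s, (p : ℝ)⁻¹) ≤ exp eulerMascheroniConstant * Real.log q := by
    calc Real.exp (∑ p ∈ s, (p : ℝ)⁻¹)
        ≤ Real.exp (Real.log (Real.log q) + eulerMascheroniConstant) :=
          Real.exp_le_exp.2 (h2.trans h3)
      _ = exp eulerMascheroniConstant * Real.log q := by
          rw [Real.exp_add, Real.exp_log hlogq]; ring
  have h5 : Real.log q < Real.log (Real.log n) := Real.log_lt_log hq0 hcase
  have hexp : 0 < exp eulerMascheroniConstant := exp_pos _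
  calc ∏ p ∈ s, (1 + (p : ℝ)⁻¹) ≤ exp eulerMascheroniConstant * Real.log q := h1.trans h4
    _ < exp eulerMascheroniConstant * Real.log (Real.log n) := mul_lt_mul_of_pos_left h5 hexp

/-! ### 5. The induction on the largest prime factor -/

/-- `∏_{p∈s} (p + 1) = (∏_{p∈s} p) · ∏_{p∈s} (1 + 1/p)` over the reals. [folklore] -/
private theorem prod_add_one_eq (s : Finset ℕ) (hs : ∀ p ∈ s, p.Prime) :
    (∏ p ∈ s, ((p : ℝ) + 1)) = (∏ p ∈ s, (p : ℝ)) * ∏ p ∈ s, (1 + (p : ℝ)⁻¹) := by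
  rw [← Finset.prod_mul_distrib]
  refine Finset.prod_congr rfl fun p hp => ?_
  have hp0 : (p : ℝ) ≠ 0 := by exact_mod_cast (hs p hp).ne_zero
  field_simp

/-- **CLMS Theorem 1.1 on prime sets**: for a nonempty finite set `s` of primes whose product is not
in `𝓑`, Robin's inequality holds at `∏_{p∈s} p` (induction on `max s`, §2).
[cite: CLMS2007, Thm 1.1 (proof, §2)] -/
theorem robinInequality_prod_primes (s : Finset ℕ) (hs : ∀ p ∈ s, p.Prime) (hne : s.Nonempty)
    (hB : (∏ p ∈ s, p) ∉ setB) : robinInequality (∏ p ∈ s, p) := by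
  induction s using Finset.induction_on_max with
  | empty => exact absurd hne Finset.not_nonempty_empty
  | insert q t hlt ih =>
    have hq : q.Prime := hs q (Finset.mem_insert_self q t)
    have ht : ∀ p ∈ t, p.Prime := fun p hp => hs p (Finset.mem_insert_of_mem hp)
    have hqt : q ∉ t := fun h => lt_irrefl q (hlt q h)
    have hq2 : 2 ≤ q := hq.two_le
    -- the product over `t`
    set n₁ := ∏ p ∈ t, p with hn₁
    have hn₁pos : 0 < n₁ := Finset.prod_pos fun p hp => (ht p hp).pos
    have hprod : ∏ p ∈ insert q t, p = q * n₁ := Finset.prod_insert hqt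
    by_cases ht0 : t = ∅
    · -- `ω(n) = 1`: `n = q` prime, `q ∉ 𝓑`, so `q ≥ 7`
      subst ht0
      simp only [Finset.prod_empty, mul_one, Finset.prod_insert (Finset.notMem_empty q)] at hB ⊢
      exact robinInequality_prime hq (seven_le_of_prime_not_mem hq hB)
    have htne : t.Nonempty := Finset.nonempty_iff_ne_empty.2 ht0
    have hn₁2 : 2 ≤ n₁ := by
      obtain ⟨p, hp⟩ := htne
      have h1 : p ∣ n₁ := Finset.dvd_prod_of_mem _ hp
      exact le_trans (ht p hp).two_le (Nat.le_of_dvd hn₁pos h1)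
    by_cases hq7 : q < 7
    · -- all primes of `n` are `≤ 5`: `n ∣ 30`, `n ∉ 𝓑`, `n ≥ 4`, so `n = 15`
      have hsub : insert q t ⊆ ({2, 3, 5} : Finset ℕ) := by
        intro p hp
        have hp' : p.Prime := hs p hp
        have hpq : p ≤ q := by
          rcases Finset.mem_insert.1 hp with rfl | hp
          · exact le_rfl
          · exact (hlt p hp).le
        have hp7 : p < 7 := lt_of_le_of_lt hpq hq7
        interval_cases p <;> simp_all (config := {decide := true})
      have hdvd : (∏ p ∈ insert q t, p) ∣ 30 := by
        have := Finset.prod_dvd_prod_of_subset (insert q t) {2, 3, 5} (fun p => p) hsub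
        simpa using this
      have hge : 4 ≤ ∏ p ∈ insert q t, p := by
        rw [hprod]; nlinarith
      have hmem : (∏ p ∈ insert q t, p) ∈ Nat.divisors 30 := Nat.mem_divisors.2 ⟨hdvd, by norm_num⟩
      generalize hn : (∏ p ∈ insert q t, p) = n at hmem hge hB ⊢
      have h30 : Nat.divisors 30 = {1, 2, 3, 5, 6, 10, 15, 30} := by decide
      rw [h30] at hmem
      simp only [Finset.mem_insert, Finset.mem_singleton] at hmem
      rcases hmem with rfl | rfl | rfl | rfl | rfl | rfl | rfl | rfl
      · omega
      · exact absurd (by simp [setB]) hB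
      · exact absurd (by simp [setB]) hB
      · exact absurd (by simp [setB]) hB
      · exact absurd (by simp [setB]) hB
      · exact absurd (by simp [setB]) hB
      · exact robinInequality_fifteen
      · exact absurd (by simp [setB]) hB
    -- `q ≥ 7`
    have hq7' : 7 ≤ q := by omega
    rw [hprod] at hB ⊢
    by_cases hB1 : n₁ ∈ setB
    · -- Corollary 2.1
      have hσ : σ 1 (q * n₁) = (q + 1) * σ 1 n₁ := by
        rw [← hprod, sigma_prod_primes _ hs, Finset.prod_insert hqt, hn₁, sigma_prod_primes _ ht]
      exact robinInequality_mul_of_mem_setB hq hq7' hB1 rfl hσ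
    -- the induction hypothesis applies to `n₁`
    have hIH : robinInequality n₁ := ih ht htne hB1
    unfold robinInequality at hIH ⊢
    have hσn : (σ 1 (q * n₁) : ℝ) = ((q : ℝ) + 1) * (σ 1 n₁ : ℝ) := by
      have : σ 1 (q * n₁) = (q + 1) * σ 1 n₁ := by
        rw [← hprod, sigma_prod_primes _ hs, Finset.prod_insert hqt, hn₁, sigma_prod_primes _ ht]
      rw [this]; push_cast; ring
    have hqR : (2 : ℝ) ≤ q := by exact_mod_cast hq2
    have hq0 : (0 : ℝ) < q := by linarith
    have hn₁R : (2 : ℝ) ≤ n₁ := by exact_mod_cast hn₁2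
    have hn₁0 : (0 : ℝ) < n₁ := by linarith
    have hexp : 0 < exp eulerMascheroniConstant := exp_pos _
    push_cast
    rw [hσn]
    by_cases hcase : Real.log ((q : ℝ) * n₁) ≤ q
    · -- Case 1
      have hc := case_one hqR hn₁R hcase
      -- `(q+1) σ(n₁) < (q+1) e^γ n₁ log log n₁ ≤ e^γ (q n₁) log log (q n₁)`
      have h1 : ((q : ℝ) + 1) * (σ 1 n₁ : ℝ) <
          ((q : ℝ) + 1) * (exp eulerMascheroniConstant * n₁ * Real.log (Real.log n₁)) :=
        mul_lt_mul_of_pos_left hIH (by linarith)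
      have h2 : ((q : ℝ) + 1) * (exp eulerMascheroniConstant * n₁ * Real.log (Real.log n₁)) ≤
          exp eulerMascheroniConstant * ((q : ℝ) * n₁) * Real.log (Real.log ((q : ℝ) * n₁)) := by
        have := mul_le_mul_of_nonneg_left hc (le_of_lt (mul_pos hexp hn₁0))
        nlinarith
      linarith
    · -- Case 2
      push Not at hcase
      have hle : ∀ p ∈ insert q t, p ≤ q := by
        intro p hp
        rcases Finset.mem_insert.1 hp with rfl | hp
        · exact le_rfl
        · exact (hlt p hp).le
      have hc := case_two (insert q t) hs (by omega) hle hcase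
      -- `σ(n) = n · ∏(1 + 1/p)`
      have hσ' : ((q : ℝ) + 1) * (σ 1 n₁ : ℝ) =
          ((q : ℝ) * n₁) * ∏ p ∈ insert q t, (1 + (p : ℝ)⁻¹) := by
        have h1 : (σ 1 (q * n₁) : ℝ) = ∏ p ∈ insert q t, ((p : ℝ) + 1) := by
          rw [← hprod, sigma_prod_primes _ hs]; push_cast; rfl
        have h2 : ((q : ℝ) * n₁) = ∏ p ∈ insert q t, (p : ℝ) := by
          rw [hn₁]; push_cast; rw [Finset.prod_insert hqt]
        rw [← hσn, h1, h2, prod_add_one_eq _ hs]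
      rw [hσ']
      have hn0 : (0 : ℝ) < (q : ℝ) * n₁ := mul_pos hq0 hn₁0
      calc ((q : ℝ) * n₁) * ∏ p ∈ insert q t, (1 + (p : ℝ)⁻¹)
          < ((q : ℝ) * n₁) * (exp eulerMascheroniConstant * Real.log (Real.log ((q : ℝ) * n₁))) :=
            mul_lt_mul_of_pos_left hc hn0
        _ = exp eulerMascheroniConstant * ((q : ℝ) * n₁) * Real.log (Real.log ((q : ℝ) * n₁)) := by
            ring


/-! ### 6. `σ(n) φ(n) ≤ n²` (Hardy–Wright Thm 329) -/

/-- **`σ(n)·φ(n) ≤ n²`** for every `n` (Hardy–Wright Thm 329: `σ(n)φ(n)/n² ≤ 1`; at a prime power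
`σ(p^k)φ(p^k) = p^{k−1}(p^{k+1} − 1)`), hence CLMS (2.7): `σ(n)/n ≤ n/φ(n)`.
[cite: HardyWright2008, Thm 329 (§18.3)] -/
theorem sigma_mul_totient_le_sq : ∀ n : ℕ, σ 1 n * Nat.totient n ≤ n ^ 2 := by
  refine Nat.recOnPosPrimePosCoprime ?_ ?_ ?_ ?_
  · intro p k hp hk
    obtain ⟨j, rfl⟩ : ∃ j, k = j + 1 := ⟨k - 1, by omega⟩
    rw [sigma_one_apply_prime_pow hp, Nat.totient_prime_pow_succ hp]
    have hp1 : 1 ≤ p := hp.one_lt.le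
    -- `(∑_{i ≤ j+1} p^i) (p − 1) + 1 = p^{j+2}`
    have hgeom : (∑ i ∈ Finset.range (j + 1 + 1), p ^ i) * (p - 1) + 1 = p ^ (j + 1 + 1) := by
      have h := geom_sum_mul_add (p - 1) (j + 1 + 1)
      rwa [Nat.sub_add_cancel hp1] at h
    have hle : (∑ i ∈ Finset.range (j + 1 + 1), p ^ i) * (p - 1) ≤ p ^ (j + 1 + 1) := by omega
    calc (∑ i ∈ Finset.range (j + 1 + 1), p ^ i) * (p ^ j * (p - 1))
        = p ^ j * ((∑ i ∈ Finset.range (j + 1 + 1), p ^ i) * (p - 1)) := by ring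
      _ ≤ p ^ j * p ^ (j + 1 + 1) := Nat.mul_le_mul_left _ hle
      _ = (p ^ (j + 1)) ^ 2 := by ring
  · simp
  · simp
  · intro a b _ _ hab ha hb
    rw [isMultiplicative_sigma.map_mul_of_coprime hab, Nat.totient_mul hab]
    calc σ 1 a * σ 1 b * (Nat.totient a * Nat.totient b)
        = (σ 1 a * Nat.totient a) * (σ 1 b * Nat.totient b) := by ring
      _ ≤ a ^ 2 * b ^ 2 := Nat.mul_le_mul ha hb
      _ = (a * b) ^ 2 := by ring

/-- CLMS (2.7) in the form `σ(n) ≤ n · (n/φ(n))` over `ℝ` (`n ≥ 1`). [cite: CLMS2007, §2 eq. (2.7)] -/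
theorem sigma_le_mul_self_div_totient {n : ℕ} (hn : n ≠ 0) :
    (σ 1 n : ℝ) ≤ n * ((n : ℝ) / Nat.totient n) := by
  have hφ : 0 < Nat.totient n := Nat.totient_pos.2 (Nat.pos_of_ne_zero hn)
  have hφR : (0 : ℝ) < Nat.totient n := by exact_mod_cast hφ
  have h := sigma_mul_totient_le_sq n
  have hR : (σ 1 n : ℝ) * Nat.totient n ≤ (n : ℝ) ^ 2 := by exact_mod_cast h
  rw [mul_div_assoc', le_div_iff₀ hφR]
  nlinarith

/-! ### 7. `n/φ(n)` as a product over the primes of `n`, and the shift bound -/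

/-- `n/φ(n) = ∏_{p ∣ n} p/(p − 1)` for `n ≥ 1` (Euler's product). [folklore] -/
private theorem self_div_totient_eq_prod {n : ℕ} (hn : n ≠ 0) :
    (n : ℝ) / Nat.totient n = ∏ p ∈ n.primeFactors, (p : ℝ) / ((p : ℝ) - 1) := by
  have h := Nat.totient_mul_prod_primeFactors n
  have hR : (Nat.totient n : ℝ) * ∏ p ∈ n.primeFactors, (p : ℝ) =
      n * ∏ p ∈ n.primeFactors, ((p : ℝ) - 1) := by
    have h' : ((Nat.totient n * ∏ p ∈ n.primeFactors, p : ℕ) : ℝ) =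
        ((n * ∏ p ∈ n.primeFactors, (p - 1) : ℕ) : ℝ) := by rw [h]
    push_cast at h'
    rw [h']
    congr 1
    refine Finset.prod_congr rfl fun p hp => ?_
    rw [Nat.cast_sub (Nat.prime_of_mem_primeFactors hp).one_lt.le, Nat.cast_one]
  have hφ : (0 : ℝ) < Nat.totient n := by exact_mod_cast Nat.totient_pos.2 (Nat.pos_of_ne_zero hn)
  have hP : 0 < ∏ p ∈ n.primeFactors, ((p : ℝ) - 1) := by
    refine Finset.prod_pos fun p hp => ?_
    have : (2 : ℝ) ≤ p := by exact_mod_cast (Nat.prime_of_mem_primeFactors hp).two_le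
    linarith
  rw [Finset.prod_div_distrib, div_eq_div_iff hφ.ne' hP.ne']
  linarith

/-- `∏_{p∈s} f(p) ≤ ∏_{p∈t} f(p)` for `s ⊆ t` when `f ≥ 0` on `s` and `f ≥ 1` on `t ∖ s` (reals).
[folklore] -/
private theorem prod_le_prod_of_subset {s t : Finset ℕ} (h : s ⊆ t) (f : ℕ → ℝ)
    (h0 : ∀ i ∈ s, 0 ≤ f i) (h1 : ∀ i ∈ t, i ∉ s → 1 ≤ f i) :
    ∏ i ∈ s, f i ≤ ∏ i ∈ t, f i := by
  rw [← Finset.prod_sdiff h]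
  have hone : 1 ≤ ∏ i ∈ t \ s, f i := by
    have : ∏ i ∈ t \ s, (1 : ℝ) ≤ ∏ i ∈ t \ s, f i :=
      Finset.prod_le_prod (fun _ _ => zero_le_one) fun i hi =>
        h1 i (Finset.mem_sdiff.1 hi).1 (Finset.mem_sdiff.1 hi).2
    simpa using this
  have hs0 : 0 ≤ ∏ i ∈ s, f i := Finset.prod_nonneg h0
  nlinarith

/-- **The shift bound** of the proof of Theorem 2.1: for a finite set `t` of integers `≥ 3` all
`< q` (`q ≥ 3`), `q/(q−1) · ∏_{p∈t} p/(p−1) ≤ (3/2) ∏_{p∈t} (1 + 1/p)`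
("`q_i/(q_i − 1) ≤ 3/2` and `q_i/(q_i − 1) < (q_{i−1} + 1)/q_{i−1}`", p. 362).
[cite: CLMS2007, §2 (proof of Thm 2.1)] -/
theorem shift_bound (t : Finset ℕ) (ht : ∀ p ∈ t, 3 ≤ p) {q : ℕ} (hq3 : 3 ≤ q)
    (hq : ∀ p ∈ t, p < q) :
    (q : ℝ) / ((q : ℝ) - 1) * ∏ p ∈ t, (p : ℝ) / ((p : ℝ) - 1) ≤
      3 / 2 * ∏ p ∈ t, (1 + (p : ℝ)⁻¹) := by
  induction t using Finset.induction_on_max generalizing q with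
  | empty =>
    simp only [Finset.prod_empty, mul_one]
    have hqR : (3 : ℝ) ≤ q := by exact_mod_cast hq3
    rw [div_le_iff₀ (by linarith)]
    linarith
  | insert p u hlt ih =>
    have hpu : p ∉ u := fun h => lt_irrefl p (hlt p h)
    have hp3 : 3 ≤ p := ht p (Finset.mem_insert_self p u)
    have hu3 : ∀ x ∈ u, 3 ≤ x := fun x hx => ht x (Finset.mem_insert_of_mem hx)
    have hpq : p < q := hq p (Finset.mem_insert_self p u)
    have ih' := ih hu3 hp3 hlt
    rw [Finset.prod_insert hpu, Finset.prod_insert hpu]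
    have hpR : (3 : ℝ) ≤ p := by exact_mod_cast hp3
    have hqR : (p : ℝ) + 1 ≤ q := by exact_mod_cast hpq
    -- `q/(q−1) ≤ 1 + 1/p` since `q ≥ p + 1`
    have h1 : (q : ℝ) / ((q : ℝ) - 1) ≤ 1 + (p : ℝ)⁻¹ := by
      rw [div_le_iff₀ (by linarith)]
      have hp0 : (0 : ℝ) < p := by linarith
      rw [← sub_nonneg]
      have : (1 + (p : ℝ)⁻¹) * ((q : ℝ) - 1) - q = ((q : ℝ) - 1 - p) / p := by
        field_simp; ring
      rw [this]
      exact div_nonneg (by linarith) hp0.le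
    have hA : 0 ≤ (p : ℝ) / ((p : ℝ) - 1) * ∏ x ∈ u, (x : ℝ) / ((x : ℝ) - 1) := by
      refine mul_nonneg (div_nonneg (by linarith) (by linarith)) (Finset.prod_nonneg fun x hx => ?_)
      have : (3 : ℝ) ≤ x := by exact_mod_cast hu3 x hx
      exact div_nonneg (by linarith) (by linarith)
    have hB : 0 ≤ 1 + (p : ℝ)⁻¹ := by positivity
    calc (q : ℝ) / ((q : ℝ) - 1) * ((p : ℝ) / ((p : ℝ) - 1) * ∏ x ∈ u, (x : ℝ) / ((x : ℝ) - 1))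
        ≤ (1 + (p : ℝ)⁻¹) * ((p : ℝ) / ((p : ℝ) - 1) * ∏ x ∈ u, (x : ℝ) / ((x : ℝ) - 1)) :=
          mul_le_mul_of_nonneg_right h1 hA
      _ = (1 + (p : ℝ)⁻¹) * ((p : ℝ) / ((p : ℝ) - 1) * ∏ x ∈ u, (x : ℝ) / ((x : ℝ) - 1)) := rfl
      _ ≤ (1 + (p : ℝ)⁻¹) * (3 / 2 * ∏ x ∈ u, (1 + (x : ℝ)⁻¹)) :=
          mul_le_mul_of_nonneg_left ih' hB
      _ = 3 / 2 * ((1 + (p : ℝ)⁻¹) * ∏ x ∈ u, (1 + (x : ℝ)⁻¹)) := by ring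

/-! ### 8. Theorem 2.1: `n/φ(n) < e^γ log log n` for odd `n ∉ {1, 3, 5, 9, 15}` -/

/-- From a checked ratio to a `log log` bound at any `n ≥ N`. [folklore] -/
private theorem lt_loglog_of_riChk {a b N n : ℕ} (h : riChk a b N = true) (hb : 0 < b) (hN : 1 < N)
    (hNn : N ≤ n) : (a : ℝ) / b < exp eulerMascheroniConstant * Real.log (Real.log n) := by
  have h1 := lt_of_riChk h hb
  have hNR : (1 : ℝ) < N := by exact_mod_cast hN
  have hNnR : (N : ℝ) ≤ n := by exact_mod_cast hNn
  have hll : Real.log (Real.log N) ≤ Real.log (Real.log n) :=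
    Real.log_le_log (Real.log_pos hNR) (Real.log_le_log (by linarith) hNnR)
  have hexp : 0 < exp eulerMascheroniConstant := exp_pos _
  nlinarith

/-- An odd `n` whose prime factors lie in `{3, 5}` and which is not `1, 3, 5, 9, 15` is `≥ 25`.
[folklore] -/
private theorem ge_25_of_primeFactors_subset {n : ℕ} (hn : n ≠ 0)
    (h35 : n.primeFactors ⊆ ({3, 5} : Finset ℕ))
    (hex : n ∉ ({1, 3, 5, 9, 15} : Finset ℕ)) : 25 ≤ n := by
  by_contra hlt
  push Not at hlt
  have key : ∀ p, p.Prime → p ∣ n → p = 3 ∨ p = 5 := by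
    intro p hp hpn
    have : p ∈ n.primeFactors := Nat.mem_primeFactors.2 ⟨hp, hpn, hn⟩
    simpa using h35 this
  have nd : ∀ p, p.Prime → p ≠ 3 → p ≠ 5 → ¬ p ∣ n := by
    intro p hp h3 h5 hpn
    rcases key p hp hpn with h | h
    · exact h3 h
    · exact h5 h
  have h2 := nd 2 Nat.prime_two (by norm_num) (by norm_num)
  have h7 := nd 7 (by norm_num) (by norm_num) (by norm_num)
  have h11 := nd 11 (by norm_num) (by norm_num) (by norm_num)
  have h13 := nd 13 (by norm_num) (by norm_num) (by norm_num)
  have h17 := nd 17 (by norm_num) (by norm_num) (by norm_num)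
  have h19 := nd 19 (by norm_num) (by norm_num) (by norm_num)
  have h23 := nd 23 (by norm_num) (by norm_num) (by norm_num)
  simp only [Finset.mem_insert, Finset.mem_singleton, not_or] at hex
  interval_cases n <;> omega

/-- **CLMS Theorem 2.1**: for every odd `n` other than `1, 3, 5, 9, 15`,
`n/φ(n) < e^γ log log n` (their set `𝓝`, "in acknowledgement of the contributions of
J.-L. Nicolas"). Proof as printed (p. 362–363): prime powers and `3^a 5^b` by Lemma 2.3
(`n/φ(n) ≤ (3/2)(5/4)(q/(q−1))`), otherwise `n/φ(n) = κ/φ(κ)` for the squarefree kernel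
`κ = q_1 ⋯ q_m`, `n/φ(n) < (3/2) ∏_{i<m} (q_i+1)/q_i = σ(n₁)/n₁` with `n₁ = 2κ/q_m`, and
Theorem 1.1 at `n₁` (or `n ∈ S` when `n₁ ∈ 𝓑`). [cite: CLMS2007, Thm 2.1] -/
theorem self_div_totient_lt {n : ℕ} (hodd : Odd n) (hex : n ∉ ({1, 3, 5, 9, 15} : Finset ℕ)) :
    (n : ℝ) / Nat.totient n < exp eulerMascheroniConstant * Real.log (Real.log n) := by
  have hn0 : n ≠ 0 := by rintro rfl; exact (Nat.not_even_iff_odd.2 hodd) (by decide)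
  set s := n.primeFactors with hs_def
  have hsP : ∀ p ∈ s, p.Prime := fun p hp => Nat.prime_of_mem_primeFactors hp
  have h2s : 2 ∉ s := by
    intro h
    have h2 : 2 ∣ n := Nat.dvd_of_mem_primeFactors h
    exact (Nat.not_even_iff_odd.2 hodd) (even_iff_two_dvd.2 h2)
  have hs3 : ∀ p ∈ s, 3 ≤ p := by
    intro p hp
    have hp2 := (hsP p hp).two_le
    rcases Nat.eq_or_lt_of_le hp2 with h | h
    · exact absurd (h ▸ hp) h2s
    · omega
  rw [self_div_totient_eq_prod hn0, ← hs_def]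
  -- the product of `p/(p−1)` over `s`
  have hfac_nonneg : ∀ p ∈ s, 0 ≤ (p : ℝ) / ((p : ℝ) - 1) := by
    intro p hp
    have : (3 : ℝ) ≤ p := by exact_mod_cast hs3 p hp
    exact div_nonneg (by linarith) (by linarith)
  have hfac_one : ∀ p : ℕ, 3 ≤ p → 1 ≤ (p : ℝ) / ((p : ℝ) - 1) := by
    intro p hp
    have : (3 : ℝ) ≤ p := by exact_mod_cast hp
    rw [le_div_iff₀ (by linarith)]; linarith
  by_cases h35 : s ⊆ ({3, 5} : Finset ℕ)
  · -- `n = 3^a 5^b`, `n ≥ 25`: `n/φ(n) ≤ (3/2)(5/4) = 15/8 < e^γ log log 25`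
    have hle : ∏ p ∈ s, (p : ℝ) / ((p : ℝ) - 1) ≤ ∏ p ∈ ({3, 5} : Finset ℕ), (p : ℝ) / ((p : ℝ) - 1) :=
      prod_le_prod_of_subset h35 _ hfac_nonneg fun p hp _ => hfac_one p (by
        simp only [Finset.mem_insert, Finset.mem_singleton] at hp; omega)
    have hval : ∏ p ∈ ({3, 5} : Finset ℕ), (p : ℝ) / ((p : ℝ) - 1) = (15 : ℝ) / (8 : ℕ) := by
      rw [Finset.prod_insert (by decide), Finset.prod_singleton]; push_cast; norm_num
    have h25 := ge_25_of_primeFactors_subset hn0 h35 hex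
    have hlt := lt_loglog_of_riChk (a := 15) (b := 8) (N := 25) (riChk_of_mem (by decide))
      (by norm_num) (by norm_num) h25
    push_cast at hval hlt
    linarith
  · -- some prime factor is `≥ 7`; let `q` be the largest prime factor
    obtain ⟨p₀, hp₀s, hp₀⟩ : ∃ p ∈ s, p ∉ ({3, 5} : Finset ℕ) := Finset.not_subset.1 h35
    have hp₀7 : 7 ≤ p₀ := by
      have h3 := hs3 p₀ hp₀s
      have hpr := hsP p₀ hp₀s
      simp only [Finset.mem_insert, Finset.mem_singleton, not_or] at hp₀
      by_contra h; push Not at h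
      interval_cases p₀ <;> first | omega | exact absurd hpr (by decide)
    have hne : s.Nonempty := ⟨p₀, hp₀s⟩
    set q := s.max' hne with hq_def
    have hqs : q ∈ s := Finset.max'_mem s hne
    have hq7 : 7 ≤ q := hp₀7.trans (Finset.le_max' s p₀ hp₀s)
    have hqP : q.Prime := hsP q hqs
    set t := s.erase q with ht_def
    have hst : s = insert q t := (Finset.insert_erase hqs).symm
    have hqt : q ∉ t := Finset.notMem_erase q s
    have htlt : ∀ p ∈ t, p < q := fun p hp =>
      lt_of_le_of_ne (Finset.le_max' s p (Finset.mem_of_mem_erase hp)) (Finset.ne_of_mem_erase hp)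
    have ht3 : ∀ p ∈ t, 3 ≤ p := fun p hp => hs3 p (Finset.mem_of_mem_erase hp)
    have htP : ∀ p ∈ t, p.Prime := fun p hp => hsP p (Finset.mem_of_mem_erase hp)
    have h2t : 2 ∉ t := fun h => h2s (Finset.mem_of_mem_erase h)
    have hqR : (7 : ℝ) ≤ q := by exact_mod_cast hq7
    -- `q/(q−1) ≤ 7/6`
    have hq76 : (q : ℝ) / ((q : ℝ) - 1) ≤ 7 / 6 := by
      rw [div_le_iff₀ (by linarith)]; linarith
    -- `n ≥ ∏_{p∈s} p = q · ∏_{p∈t} p`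
    have hrad : (∏ p ∈ s, p) ∣ n := Nat.prod_primeFactors_dvd n
    have hradle : q * ∏ p ∈ t, p ≤ n := by
      have := Nat.le_of_dvd (Nat.pos_of_ne_zero hn0) hrad
      rwa [hst, Finset.prod_insert hqt] at this
    have htpos : 0 < ∏ p ∈ t, p := Finset.prod_pos fun p hp => (htP p hp).pos
    rw [hst, Finset.prod_insert hqt]
    by_cases ht0 : t = ∅
    · -- `n = q^c`: `q/(q−1) ≤ 7/6 < e^γ log log 7 ≤ e^γ log log n`
      rw [ht0, Finset.prod_empty, mul_one]
      have hlt := lt_loglog_of_riChk (a := 7) (b := 6) (N := 7) (riChk_of_mem (by decide))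
        (by norm_num) (by norm_num) (le_trans (by simpa [ht0] using hq7) hradle)
      push_cast at hlt
      linarith
    have htne : t.Nonempty := Finset.nonempty_iff_ne_empty.2 ht0
    -- the shift bound: `q/(q−1) ∏_t p/(p−1) ≤ (3/2) ∏_t (1 + 1/p) = ∏_{insert 2 t} (1 + 1/p)`
    have hshift := shift_bound t ht3 (by omega) htlt
    set n₁ := ∏ p ∈ insert 2 t, p with hn₁
    have hn₁eq : n₁ = 2 * ∏ p ∈ t, p := Finset.prod_insert h2t
    have hs₁P : ∀ p ∈ insert 2 t, p.Prime := by
      intro p hp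
      rcases Finset.mem_insert.1 hp with rfl | hp
      · exact Nat.prime_two
      · exact htP p hp
    by_cases hB : n₁ ∈ setB
    · -- `n₁ = 2 ∏ t ∈ 𝓑`: `∏ t ∈ {3, 5, 15}`, i.e. `t ⊆ {3, 5}` with the stated product
      have hcases : (∏ p ∈ t, p) = 3 ∨ (∏ p ∈ t, p) = 5 ∨ (∏ p ∈ t, p) = 15 := by
        have h2le : 2 ≤ ∏ p ∈ t, p := by
          obtain ⟨p, hp⟩ := htne
          exact le_trans (htP p hp).two_le (Nat.le_of_dvd htpos (Finset.dvd_prod_of_mem _ hp))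
        simp only [setB, Finset.mem_insert, Finset.mem_singleton, hn₁eq] at hB
        omega
      -- every prime of `t` divides `∏ t ∈ {3,5,15}`, so `t ⊆ {3,5}`
      have htsub : t ⊆ ({3, 5} : Finset ℕ) := by
        intro p hp
        have hpd : p ∣ ∏ x ∈ t, x := Finset.dvd_prod_of_mem _ hp
        have hpP := htP p hp
        have hp15 : p ∣ 15 := by
          rcases hcases with h | h | h <;> rw [h] at hpd
          · exact hpd.trans (by norm_num)
          · exact hpd.trans (by norm_num)
          · exact hpd
        have hp_le : p ≤ 15 := Nat.le_of_dvd (by norm_num) hp15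
        have hp3 := ht3 p hp
        simp only [Finset.mem_insert, Finset.mem_singleton]
        interval_cases p <;> first | omega | exact absurd hpP (by decide)
      have hFt : ∏ p ∈ t, (p : ℝ) / ((p : ℝ) - 1) ≤ 15 / 8 := by
        have hle := prod_le_prod_of_subset htsub (fun p => (p : ℝ) / ((p : ℝ) - 1))
          (fun p hp => hfac_nonneg p (Finset.mem_of_mem_erase hp)) fun p hp _ => hfac_one p (by
            simp only [Finset.mem_insert, Finset.mem_singleton] at hp; omega)
        have hval : ∏ p ∈ ({3, 5} : Finset ℕ), (p : ℝ) / ((p : ℝ) - 1) = 15 / 8 := by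
          rw [Finset.prod_insert (by decide), Finset.prod_singleton]; push_cast; norm_num
        linarith
      have hFt0 : 0 ≤ ∏ p ∈ t, (p : ℝ) / ((p : ℝ) - 1) :=
        Finset.prod_nonneg fun p hp => hfac_nonneg p (Finset.mem_of_mem_erase hp)
      -- finer: if `∏ t = 3` then `t ⊆ {3}` and the product is `≤ 3/2`; if `5`, `≤ 5/4`
      rcases hcases with h3 | h5 | h15
      · have ht3' : t ⊆ ({3} : Finset ℕ) := by
          intro p hp
          have hpd : p ∣ ∏ x ∈ t, x := Finset.dvd_prod_of_mem _ hp
          rw [h3] at hpd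
          have := (Nat.prime_dvd_prime_iff_eq (htP p hp) Nat.prime_three).1 hpd
          simp [this]
        have hFt' : ∏ p ∈ t, (p : ℝ) / ((p : ℝ) - 1) ≤ 3 / 2 := by
          have hle := prod_le_prod_of_subset ht3' (fun p => (p : ℝ) / ((p : ℝ) - 1))
            (fun p hp => hfac_nonneg p (Finset.mem_of_mem_erase hp)) fun p hp _ => hfac_one p (by
              simp only [Finset.mem_singleton] at hp; omega)
          have hval : ∏ p ∈ ({3} : Finset ℕ), (p : ℝ) / ((p : ℝ) - 1) = 3 / 2 := by
            rw [Finset.prod_singleton]; push_cast; norm_num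
          linarith
        have hN : 21 ≤ n := le_trans (by rw [h3]; omega) hradle
        have hlt := lt_loglog_of_riChk (a := 7) (b := 4) (N := 21) (riChk_of_mem (by decide))
          (by norm_num) (by norm_num) hN
        push_cast at hlt
        nlinarith
      · have ht5' : t ⊆ ({5} : Finset ℕ) := by
          intro p hp
          have hpd : p ∣ ∏ x ∈ t, x := Finset.dvd_prod_of_mem _ hp
          rw [h5] at hpd
          have := (Nat.prime_dvd_prime_iff_eq (htP p hp) Nat.prime_five).1 hpd
          simp [this]
        have hFt' : ∏ p ∈ t, (p : ℝ) / ((p : ℝ) - 1) ≤ 5 / 4 := by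
          have hle := prod_le_prod_of_subset ht5' (fun p => (p : ℝ) / ((p : ℝ) - 1))
            (fun p hp => hfac_nonneg p (Finset.mem_of_mem_erase hp)) fun p hp _ => hfac_one p (by
              simp only [Finset.mem_singleton] at hp; omega)
          have hval : ∏ p ∈ ({5} : Finset ℕ), (p : ℝ) / ((p : ℝ) - 1) = 5 / 4 := by
            rw [Finset.prod_singleton]; push_cast; norm_num
          linarith
        have hN : 35 ≤ n := le_trans (by rw [h5]; omega) hradle
        have hlt := lt_loglog_of_riChk (a := 35) (b := 24) (N := 35) (riChk_of_mem (by decide))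
          (by norm_num) (by norm_num) hN
        push_cast at hlt
        nlinarith
      · have hN : 105 ≤ n := le_trans (by rw [h15]; omega) hradle
        have hlt := lt_loglog_of_riChk (a := 35) (b := 16) (N := 105) (riChk_of_mem (by decide))
          (by norm_num) (by norm_num) hN
        push_cast at hlt
        nlinarith
    · -- Theorem 1.1 at the even squarefree `n₁ = 2 ∏ t ∉ 𝓑`
      have hRI := robinInequality_prod_primes (insert 2 t) hs₁P ⟨2, Finset.mem_insert_self 2 t⟩ hB
      unfold robinInequality at hRI
      have hn₁pos : 0 < n₁ := Finset.prod_pos fun p hp => (hs₁P p hp).pos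
      have hn₁R : (0 : ℝ) < n₁ := by exact_mod_cast hn₁pos
      -- `σ(n₁) = n₁ ∏ (1 + 1/p)`
      have hσ : (σ 1 n₁ : ℝ) = (n₁ : ℝ) * ∏ p ∈ insert 2 t, (1 + (p : ℝ)⁻¹) := by
        rw [hn₁, sigma_prod_primes _ hs₁P]; push_cast
        rw [prod_add_one_eq _ hs₁P]
      rw [hσ] at hRI
      have hprod : ∏ p ∈ insert 2 t, (1 + (p : ℝ)⁻¹) <
          exp eulerMascheroniConstant * Real.log (Real.log n₁) := by
        have := hRI
        nlinarith
      have h32 : ∏ p ∈ insert 2 t, (1 + (p : ℝ)⁻¹) = 3 / 2 * ∏ p ∈ t, (1 + (p : ℝ)⁻¹) := by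
        rw [Finset.prod_insert h2t]; norm_num
      -- `n₁ ≤ n`, so `log log n₁ ≤ log log n`
      have hn₁le : n₁ ≤ n := by
        rw [hn₁eq]
        exact le_trans (Nat.mul_le_mul_right _ (by omega : 2 ≤ q)) hradle
      have hn₁2 : (2 : ℝ) ≤ n₁ := by
        have : 2 ≤ n₁ := by rw [hn₁eq]; omega
        exact_mod_cast this
      have hll : Real.log (Real.log n₁) ≤ Real.log (Real.log n) :=
        Real.log_le_log (Real.log_pos (by linarith)) (Real.log_le_log (by linarith)
          (by exact_mod_cast hn₁le))
      have hexp : 0 < exp eulerMascheroniConstant := exp_pos _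
      calc (q : ℝ) / ((q : ℝ) - 1) * ∏ p ∈ t, (p : ℝ) / ((p : ℝ) - 1)
          ≤ 3 / 2 * ∏ p ∈ t, (1 + (p : ℝ)⁻¹) := hshift
        _ = ∏ p ∈ insert 2 t, (1 + (p : ℝ)⁻¹) := h32.symm
        _ < exp eulerMascheroniConstant * Real.log (Real.log n₁) := hprod
        _ ≤ exp eulerMascheroniConstant * Real.log (Real.log n) :=
            mul_le_mul_of_nonneg_left hll hexp.le

end CLMS2007

open CLMS2007

/-- **CLMS 2007, Theorem 1.1** (Robin's inequality for squarefree integers): every squarefree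
`n ≠ 1` not in `𝓑 = {2, 3, 5, 6, 10, 30}` satisfies `σ(n) < e^γ n log log n`. As printed: "Every
squarefree integer that is not in 𝓑 is an element of 𝓡"; `n = 1` (squarefree, `∉ 𝓑`,
`σ(1) = 1 ≥ 0`) must be excluded and is here. Unconditional. [cite: CLMS2007, Thm 1.1] -/
theorem robinInequality_of_squarefree {n : ℕ} (hn : Squarefree n) (h1 : n ≠ 1)
    (hB : n ∉ ({2, 3, 5, 6, 10, 30} : Finset ℕ)) : robinInequality n := by
  have hn0 : n ≠ 0 := fun h => by subst h; exact not_squarefree_zero hn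
  have hprod : ∏ p ∈ n.primeFactors, p = n := Nat.prod_primeFactors_of_squarefree hn
  have hne : n.primeFactors.Nonempty := by
    rw [Finset.nonempty_iff_ne_empty, Ne, Nat.primeFactors_eq_empty]
    omega
  have h := robinInequality_prod_primes n.primeFactors (fun p hp => Nat.prime_of_mem_primeFactors hp)
    hne (by rw [hprod]; exact hB)
  rwa [hprod] at h

/-- CLMS Theorem 1.1 in the range of Robin's criterion: every squarefree `n > 30` satisfies Robin's
inequality. [cite: CLMS2007, Thm 1.1] -/
theorem robinInequality_of_squarefree_of_gt {n : ℕ} (hn : Squarefree n) (h30 : 30 < n) :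
    robinInequality n :=
  robinInequality_of_squarefree hn (by omega) (by
    simp only [Finset.mem_insert, Finset.mem_singleton]; omega)


/-- **CLMS 2007, Theorem 2.1** (exported): `n/φ(n) < e^γ log log n` for every odd `n` other than
`1, 3, 5, 9, 15`. [cite: CLMS2007, Thm 2.1] -/
theorem CLMS2007_thm_2_1 {n : ℕ} (hodd : Odd n) (hex : n ∉ ({1, 3, 5, 9, 15} : Finset ℕ)) :
    (n : ℝ) / Nat.totient n < Real.exp Real.eulerMascheroniConstant * Real.log (Real.log n) :=
  CLMS2007.self_div_totient_lt hodd hex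

/-- **CLMS 2007, Theorem 1.2** (Robin's inequality for odd integers): "Any odd positive integer `n`
distinct from `1, 3, 5` and `9` is in `𝓡`", i.e. satisfies `σ(n) < e^γ n log log n`. From
Theorem 2.1 and `σ(n)/n ≤ n/φ(n)` ((2.7)); `n = 15` directly. Unconditional.
[cite: CLMS2007, Thm 1.2] -/
theorem robinInequality_of_odd {n : ℕ} (hodd : Odd n) (hex : n ∉ ({1, 3, 5, 9} : Finset ℕ)) :
    robinInequality n := by
  by_cases h15 : n = 15
  · subst h15; exact robinInequality_fifteen
  have hn0 : n ≠ 0 := by rintro rfl; exact (Nat.not_even_iff_odd.2 hodd) (by decide)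
  have hex' : n ∉ ({1, 3, 5, 9, 15} : Finset ℕ) := by
    simp only [Finset.mem_insert, Finset.mem_singleton, not_or] at hex ⊢
    exact ⟨hex.1, hex.2.1, hex.2.2.1, hex.2.2.2, h15⟩
  have h1 := CLMS2007.self_div_totient_lt hodd hex'
  have h2 := CLMS2007.sigma_le_mul_self_div_totient hn0
  have hnR : (0 : ℝ) < n := by exact_mod_cast Nat.pos_of_ne_zero hn0
  unfold robinInequality
  calc (σ 1 n : ℝ) ≤ n * ((n : ℝ) / Nat.totient n) := h2
    _ < n * (exp eulerMascheroniConstant * Real.log (Real.log n)) := mul_lt_mul_of_pos_left h1 hnR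
    _ = exp eulerMascheroniConstant * n * Real.log (Real.log n) := by ring

end Literature.NumberTheory.LFunctions
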